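import Literature.MathematicalPhysics.QuantumFieldTheory.Balaban1983to89.B6BlockHolderGDivCompositesV1
import Literature.MathematicalPhysics.QuantumFieldTheory.Balaban1983to89.B6Prop25GDivDecayTwoScaleV1

/-!
# `Balaban1983to89.B6Prop25HolderGDivTwoScaleV1` — T. Bałaban, *Propagators and renormalization transformations for lattice gauge theories. II*,
# Commun. Math. Phys. **96** (1984) 223–250 [Balaban1984PropagatorsII], PROPOSITION 2.5 p. 246, THE HÖLDER MEMBER `‖ζG∇*J‖_α` OF (1.111) FOR THE
# GENUINE TWO-SCALE `G = Δ_a⁻¹` OF (2.90), `Λ′ ⊂ T^{(j+1)}` ARBITRARY, for `tsV1` at the paper's scaling — file 9 of the Hölder programme (p38),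
# the assembly; the Hölder twin of p22's `B6Prop25GDivDecayTwoScaleV1`

statement-level skeleton of published theorems with citation tags; proofs where landed; nothing here is a claim about the Yang–Mills mass gap

p. 246 (Proposition 2.5, verbatim): *"The operator G defined by (2.90) … has the representation (2.129) and satisfies all the inequalities
(1.110)–(1.114) of the Proposition 1.2 with a positive constant δ₂ instead of δ₀. This constant depends on d and L only."*  [4] (1.111) p. 35:
*"‖ζ∇GJ‖_α, ‖ζG∇*J‖_α ≤ O(1)e^{−δ₀|y−y′|}(‖ζ‖_α + |ζ|)|J| for 0 ≤ α < 1, ζ ∈ C^∞(Δ̃(y)), supp J ⊂ Δ̃(y′), with the constant O(1) depending on d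
and α (O(1) → ∞ if α → 1)"*.

WHAT THIS FILE DOES.  Composing (2.129) (p22's `G_eq_op_V1`) on the right with `∇_λ* = n(S_λ⁻¹ − I)`,
`G∇_λ* = K₁∇_λ* + (I − K₂*)Y`, `Y = (G̃_j∇_λ* + H_jC̃H_j*∇_λ*) − M(K₂∇_λ*)`, `M = G̃_j + H_jC̃^{(j)}_ΛH_j*`, and `(I − K₂*)Y = Y − K₂*Y`: every FIRST
factor has a uniform PAIR bound (files 7–8: `holderBound_K1Dadj_scaling`, `holderBound_GtDadj_scaling`, `holderBound_HjCtDHjadj_scaling`,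
`holderBound_Gt_scaling`, `holderBound_HjCtHj_scaling`, `holderBound_K2adj_scaling`) and every tail a uniform block bound (p22 files 3, 6, 13, 14);
file 1's pair calculus gives §1 **`holderBound_GDadj_scaling`**: `δ₂ > 0` depending on `d, L, a₀, a₁` only and, for every `0 ≤ α < 1`, `C_α ≥ 0`
with `Σ_{b₀′ : y(b₀′₋) = y}|(G∇_λ*)(e_{b₀′})_{b₁} − (G∇_λ*)(e_{b₀′})_{b₂}| ≤ C_α·t^α·e^{−δ₂|y(x) − y|_T}` for fine bonds `b₁ = ⟨x, ν⟩`, `b₂ = ⟨x′, ν⟩`,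
`t = |x − x′|_∞/n ≤ 1`; and §2 THE PRINTED SHAPE **`prop25_ineq111_div`** with a cut-off `ζ` (`|ζ| ≤ Z₀`, `|ζ(x) − ζ(x′)| ≤ Z_h t^α`, supported
over the unit sites within `r` of `y`) and `J` supported over the unit sites within `r` of `y′`, `|J| ≤ X`:
`|ζ(x)(G∇_λ*J)_ν(x) − ζ(x′)(G∇_λ*J)_ν(x′)| ≤ C_α·e^{(1+2δ₂)(r+1)}·e^{−δ₂|y − y′|_T}·(Z_h + Z₀)·X·t^α` (sup part: p22's `blockBound_GDadj_scaling`).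

HONEST SCOPE / DIVERGENCES. (1) Here the decay RATE `δ₂` does NOT depend on `α` (as printed): the only Hölder input is [4] (1.111) for `G_k`
(file 6), `H_j` and `∂H′_j` enter through Lipschitz bounds. (2) Pairs of bonds of equal direction with `|x − x′|_∞ ≤ n`; `∇_λ*` = the
`ℓ²`-adjoint of the forward difference with the factor `η⁻¹ = L^j`, one component `λ` of the divergence at a time. (3) `ζ ∈ C^∞(Δ̃(y))`,
`supp J ⊂ Δ̃(y′)` replaced by supports within radius `r` (growth `e^{(1+2δ₂)(r+1)}`), as in p22's (1.110) files. (4) No new definition, no new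
hypothesis.  v1.1 (p38 gen 23, PROOF-ONLY, statements byte-identical): `holderBound_GDadj_scaling` elaborates at the DEFAULT heartbeat budget
(v1.0: `maxHeartbeats 800000`) — the block/pair-bound theorems are instantiated with `_` for the operator terms, the algebra (d) goes through the
generic `comp_eq_of_G_eq` (no `tsV1` operator restated), the rate/constant bookkeeping is done once by explicit terms.  NOT summit progress.
Unit `lit-balaban-p38` (gen 21; v1.1 gen 23), 2026-08-22.
-/

noncomputable section

open scoped InnerProductSpace BigOperators
open Finset

namespace Literature.MathematicalPhysics.QuantumFieldTheory.Balaban1983to89.B6Prop25HolderGDivTwoScaleV1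

open LatticeFieldCalculus B5SectBStatements B5Eq117TorusCarriers B6SectAOperatorsV1 B6SectCOperators
  B6SectCTwoScaleV1 B6SectCTwoScaleV1Lattice B5Eq118OneStroke
open BalabanImbrieJaffe1984to88.BIJ85AxialPropagator411 (BondSpace)
open B4Sect5Torus (IsPseudoDist SumBound)
open B4TorusKernel.MultiPeriod (torusSupNorm torusSupNorm_nonneg)
open B4Sect5Proof (latticeConst latticeConst_nonneg)
open B6LowerBound2153Torus (rep)
open B6Repr2129Operator (G_eq_op_V1)
open B6BlockDecayCalculus (blockBound_comp blockBound_add blockBound_sub blockBound_mono abs_apply_le_of_support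
  torusDist_isPseudoDist torusDist_sumBound)
open B6BlockDecayHjCovV1 (blockBound_HjCtHj_scaling)
open B6BlockDecayHprimeCovV1 (supDist_cast_eq_torusSupNorm)
open B6BlockDecayGtV1 (blockBound_Gt_scaling)
open B6BlockDecayGDivFactorsV1 (blockBound_K2Dadj_scaling blockBound_HjCtDHjadj_scaling)
open B6Prop25GDivDecayTwoScaleV1 (blockBound_GtDadj_scaling blockBound_GDadj_scaling)
open B6BlockHolderCalculus (holderBound_comp holderBound_add holderBound_sub holderBound_mono pairDiff_le_of_support abs_cutoff_pairDiff_le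
  self_le_rpow_of_le_one')
open B6BlockHolderLipFactorsV1 (holderBound_K2adj_scaling holderBound_Gt_scaling holderBound_HjCtHj_scaling)
open B6BlockHolderGDivCompositesV1 (holderBound_K1Dadj_scaling holderBound_HjCtDHjadj_scaling holderBound_GtDadj_scaling)
open BalabanImbrieJaffe1984to88.BIJ85Ineq722Torus (supDist_blk_le_one)

variable {d L m K : ℕ} {hd : 1 ≤ d + 1} {hL : Odd L ∧ 1 < L} {j : ℕ}

/-! ## §1  The pair bound of `G∇_λ*`: Proposition 2.5, the Hölder member `‖ζG∇*J‖_α` of (1.111), uniformly -/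

/-- the operator algebra of (2.129) composed with `∇_λ*` (generic, so that no operator of `tsV1` is restated): from
`G = K₁ + (I − K₂)*M(I − K₂)`, `G∘D = K₁∘D + (Y − K₂*Y)` with `Y = (G̃D + H C̃ H*D) − M(K₂D)`, `M = G̃ + H C̃ H*`.
[cite: Balaban1984PropagatorsII, (2.129)–(2.131) p.246] -/
private theorem comp_eq_of_G_eq {V : Type*} [NormedAddCommGroup V] [InnerProductSpace ℝ V] [FiniteDimensional ℝ V]
    {G K1 K2 Gt HCH D : V →ₗ[ℝ] V}
    (hG : G = K1 + LinearMap.adjoint (LinearMap.id - K2) ∘ₗ (Gt + HCH) ∘ₗ (LinearMap.id - K2)) :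
    G ∘ₗ D = K1 ∘ₗ D + ((Gt ∘ₗ D + HCH ∘ₗ D - (Gt + HCH) ∘ₗ (K2 ∘ₗ D)) -
      LinearMap.adjoint K2 ∘ₗ (Gt ∘ₗ D + HCH ∘ₗ D - (Gt + HCH) ∘ₗ (K2 ∘ₗ D))) := by
  rw [hG, map_sub, LinearMap.adjoint_id]
  refine LinearMap.ext fun v => ?_
  simp only [LinearMap.comp_apply, LinearMap.add_apply, LinearMap.sub_apply, LinearMap.id_apply, map_add, map_sub]
  abel

open Classical in
/-- **PROPOSITION 2.5, THE HÖLDER CONTINUITY OF `G∇*` FOR THE TWO-SCALE `G` AS A PAIR BOUND** (at `c = L^j`, weights `a₀n^{d+1} ≤ w ≤ a₁n^{d+1}`):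
there is `δ₂ > 0` depending on `d, L, a₀, a₁` only and for every `0 ≤ α < 1` a `C_α ≥ 0` such that for every volume, `j + 1 ≤ m + K`, `Λ′`,
weights in the window, direction `λ`, fine bonds `b₁ = ⟨x, ν⟩`, `b₂ = ⟨x′, ν⟩` with `|x − x′|_∞ ≤ n` and unit site `y`:
`Σ_{b₀′ : y(b₀′₋) = y}|(G∇_λ*)(e_{b₀′})_{b₁} − (G∇_λ*)(e_{b₀′})_{b₂}| ≤ C_α·(|x − x′|_∞/n)^α·e^{−δ₂|y(x) − y|_T}` — (2.129)∘`∇_λ*`,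
`G∇_λ* = K₁∇_λ* + Y − K₂*Y`, first factors by their pair bounds (files 7–8; the Lipschitz ones via `t ≤ t^α`), tails by their block bounds
(p22 files 3, 6, 13, 14), composed by file 1. [cite: Balaban1984PropagatorsII, Prop. 2.5 p.246; Balaban1984PropagatorsI, (1.111) p.35] -/
theorem holderBound_GDadj_scaling (d L : ℕ) (hd : 1 ≤ d + 1) (hL : Odd L ∧ 1 < L) {a₀ a₁ : ℝ} (ha₀ : 0 < a₀) (ha₁ : a₀ ≤ a₁) :
    ∃ δ : ℝ, 0 < δ ∧ ∀ α : ℝ, 0 ≤ α → α < 1 → ∃ C : ℝ, 0 ≤ C ∧ ∀ (m K : ℕ) (j : ℕ) (hc : ((L : ℝ) ^ j) ≠ 0)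
      (_hj : j + 1 ≤ (⟨d + 1, L, m, K, hd, hL⟩ : Params).m + (⟨d + 1, L, m, K, hd, hL⟩ : Params).K)
      (Λ' : Finset (Site (⟨d + 1, L, m, K, hd, hL⟩ : Params) (j + 1))) (w : CIdx j Λ' → ℝ)
      (_hw0 : ∀ i, a₀ * ((L : ℝ) ^ j) ^ (d + 1) ≤ w i) (_hw1 : ∀ i, w i ≤ a₁ * ((L : ℝ) ^ j) ^ (d + 1)) (lam : Fin (d + 1))
      (b₁ b₂ : PBond (⟨d + 1, L, m, K, hd, hL⟩ : Params) 0) (_hdir : b₁.dir = b₂.dir) (_hle : supDist b₁.src b₂.src ≤ L ^ j) (y : Site (⟨d + 1, L, m, K, hd, hL⟩ : Params) j),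
      ∑ b₀' ∈ univ.filter (fun b₀' : PBond (⟨d + 1, L, m, K, hd, hL⟩ : Params) 0 => iterBlockOf j b₀'.src = y),
          |((tsV1 hc Λ' w).G ∘ₗ ((((L : ℝ) ^ j) • (onE (LinearMap.funLeft ℝ ℝ (fun b : PBond (⟨d + 1, L, m, K, hd, hL⟩ : Params) 0 => (⟨b.src.unshift lam, b.dir⟩ : PBond (⟨d + 1, L, m, K, hd, hL⟩ : Params) 0))) - LinearMap.id) : BondSpace (⟨d + 1, L, m, K, hd, hL⟩ : Params) →ₗ[ℝ] BondSpace (⟨d + 1, L, m, K, hd, hL⟩ : Params)))) (EuclideanSpace.single b₀' (1 : ℝ)) b₁ -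
           ((tsV1 hc Λ' w).G ∘ₗ ((((L : ℝ) ^ j) • (onE (LinearMap.funLeft ℝ ℝ (fun b : PBond (⟨d + 1, L, m, K, hd, hL⟩ : Params) 0 => (⟨b.src.unshift lam, b.dir⟩ : PBond (⟨d + 1, L, m, K, hd, hL⟩ : Params) 0))) - LinearMap.id) : BondSpace (⟨d + 1, L, m, K, hd, hL⟩ : Params) →ₗ[ℝ] BondSpace (⟨d + 1, L, m, K, hd, hL⟩ : Params)))) (EuclideanSpace.single b₀' (1 : ℝ)) b₂| ≤
        C * (((supDist b₁.src b₂.src : ℕ) : ℝ) / (L : ℝ) ^ j) ^ α * Real.exp (-(δ * torusSupNorm (Mk (⟨d + 1, L, m, K, hd, hL⟩ : Params) j)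
            (rep (Mk (⟨d + 1, L, m, K, hd, hL⟩ : Params) j) (iterBlockOf j b₁.src) - rep (Mk (⟨d + 1, L, m, K, hd, hL⟩ : Params) j) y))) := by
  obtain ⟨δ₁, hδ₁, C₁, hC₁, hK1D⟩ := holderBound_K1Dadj_scaling d L hd hL
  obtain ⟨δ₂, hδ₂, C₂, hC₂, hK2D⟩ := blockBound_K2Dadj_scaling d L hd hL
  obtain ⟨δ₃, hδ₃, C₃, hC₃, hK2a⟩ := holderBound_K2adj_scaling d L hd hL
  obtain ⟨δ₄, hδ₄, C₄, hC₄, hHCH⟩ := blockBound_HjCtHj_scaling d L hd hL ha₀ ha₁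
  obtain ⟨δ₅, hδ₅, C₅, hC₅, hGt⟩ := blockBound_Gt_scaling d L hd hL
  obtain ⟨δ₆, hδ₆, C₆, hC₆, hHCHD⟩ := blockBound_HjCtDHjadj_scaling d L hd hL ha₀ ha₁
  obtain ⟨δ₇, hδ₇, C₇, hC₇, hGtD⟩ := blockBound_GtDadj_scaling d L hd hL
  obtain ⟨δ₈, hδ₈, C₈, hC₈, hpHCH⟩ := holderBound_HjCtHj_scaling d L hd hL ha₀ ha₁
  obtain ⟨δ₉, hδ₉, C₉, hC₉, hpGt⟩ := holderBound_Gt_scaling d L hd hL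
  obtain ⟨δ₁₀, hδ₁₀, C₁₀, hC₁₀, hpHCHD⟩ := holderBound_HjCtDHjadj_scaling d L hd hL ha₀ ha₁
  obtain ⟨δ₁₁, hδ₁₁, HGtD⟩ := holderBound_GtDadj_scaling d L hd hL
  -- the common `α`-free rate
  set δ₀ : ℝ := min (min (min (min δ₁ δ₂) (min δ₃ δ₄)) (min (min δ₅ δ₆) (min δ₇ δ₈))) (min (min δ₉ δ₁₀) δ₁₁) with hδ₀
  have hδ₀0 : 0 < δ₀ :=
    lt_min (lt_min (lt_min (lt_min hδ₁ hδ₂) (lt_min hδ₃ hδ₄)) (lt_min (lt_min hδ₅ hδ₆) (lt_min hδ₇ hδ₈))) (lt_min (lt_min hδ₉ hδ₁₀) hδ₁₁)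
  have h01 : δ₀ ≤ δ₁ := (min_le_left _ _).trans ((min_le_left _ _).trans ((min_le_left _ _).trans (min_le_left _ _)))
  have h02 : δ₀ ≤ δ₂ := (min_le_left _ _).trans ((min_le_left _ _).trans ((min_le_left _ _).trans (min_le_right _ _)))
  have h03 : δ₀ ≤ δ₃ := (min_le_left _ _).trans ((min_le_left _ _).trans ((min_le_right _ _).trans (min_le_left _ _)))
  have h04 : δ₀ ≤ δ₄ := (min_le_left _ _).trans ((min_le_left _ _).trans ((min_le_right _ _).trans (min_le_right _ _)))
  have h05 : δ₀ ≤ δ₅ := (min_le_left _ _).trans ((min_le_right _ _).trans ((min_le_left _ _).trans (min_le_left _ _)))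
  have h06 : δ₀ ≤ δ₆ := (min_le_left _ _).trans ((min_le_right _ _).trans ((min_le_left _ _).trans (min_le_right _ _)))
  have h07 : δ₀ ≤ δ₇ := (min_le_left _ _).trans ((min_le_right _ _).trans ((min_le_right _ _).trans (min_le_left _ _)))
  have h08 : δ₀ ≤ δ₈ := (min_le_left _ _).trans ((min_le_right _ _).trans ((min_le_right _ _).trans (min_le_right _ _)))
  have h09 : δ₀ ≤ δ₉ := (min_le_right _ _).trans ((min_le_left _ _).trans (min_le_left _ _))
  have h010 : δ₀ ≤ δ₁₀ := (min_le_right _ _).trans ((min_le_left _ _).trans (min_le_right _ _))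
  have h011 : δ₀ ≤ δ₁₁ := (min_le_right _ _).trans (min_le_right _ _)
  -- rate bookkeeping, ONCE (explicit terms; v1.0 re-proved these by `linarith`/`positivity` inside the large context)
  have hh0 : (0 : ℝ) ≤ δ₀ / 2 := div_nonneg hδ₀0.le zero_le_two
  have hh : δ₀ / 2 ≤ δ₀ := div_le_self hδ₀0.le one_le_two
  have hh2 : δ₀ / 2 < δ₀ := div_lt_self hδ₀0 one_lt_two
  have h40 : (0 : ℝ) ≤ δ₀ / 4 := div_nonneg hδ₀0.le zero_le_four
  have h4lt : δ₀ / 4 < δ₀ := div_lt_self hδ₀0 (by norm_num)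
  have hq : δ₀ / 4 ≤ δ₀ := h4lt.le
  have h42 : δ₀ / 4 ≤ δ₀ / 2 := div_le_div_of_nonneg_left hδ₀0.le two_pos (by norm_num)
  set Ka : ℝ := latticeConst (d + 1) (δ₀ - δ₀ / 2) with hKa
  set Kb : ℝ := latticeConst (d + 1) (δ₀ - δ₀ / 4) with hKb
  have hKa0 : 0 ≤ Ka := latticeConst_nonneg _ (sub_nonneg.mpr hh)
  have hKb0 : 0 ≤ Kb := latticeConst_nonneg _ (sub_nonneg.mpr hq)
  have hL0 : 0 < L := by have := hL.2; omega
  have hLp : (0 : ℝ) < L := by exact_mod_cast hL0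
  refine ⟨δ₀ / 4, div_pos hδ₀0 four_pos, fun α hα0 hα1 => ?_⟩
  obtain ⟨C₁₁, hC₁₁, hpGtD⟩ := HGtD α hα0 hα1
  -- the block constant `C_Y` and the pair constant `C′_Y` of `Y` (coefficient of `t^α`), both at the rate `δ₀/2`
  -- (`obtain`, not `set`: `set` rewrites `at *` through the eleven large factor hypotheses — 2 s each in v1.0)
  obtain ⟨CY, hCY⟩ : ∃ CY : ℝ, CY = (C₇ + C₆) + (C₅ + C₄) * C₂ * Ka := ⟨_, rfl⟩
  have hCY0 : 0 ≤ CY := by rw [hCY]; exact add_nonneg (add_nonneg hC₇ hC₆) (mul_nonneg (mul_nonneg (add_nonneg hC₅ hC₄) hC₂) hKa0)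
  obtain ⟨C, hC⟩ : ∃ C : ℝ, C = C₁ + (((C₁₁ + C₁₀) + (C₉ + C₈) * C₂ * Ka) + C₃ * CY * Kb) := ⟨_, rfl⟩
  have hC0 : 0 ≤ C := by
    rw [hC]; exact add_nonneg hC₁ (add_nonneg (add_nonneg (add_nonneg hC₁₁ hC₁₀) (mul_nonneg (mul_nonneg (add_nonneg hC₉ hC₈) hC₂) hKa0)) (mul_nonneg (mul_nonneg hC₃ hCY0) hKb0))
  refine ⟨C, hC0, ?_⟩
  intro m K j hc hj Λ' w hw0 hw1 lam b₁ b₂ hdir hle y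
  have hLj : (0 : ℝ) < (L : ℝ) ^ j := pow_pos hLp j
  have hw : ∀ i, 0 < w i := fun i => lt_of_lt_of_le (mul_pos ha₀ (pow_pos hLj (d + 1))) (hw0 i)
  have hρ : IsPseudoDist (fun t t' : Site (⟨d + 1, L, m, K, hd, hL⟩ : Params) j => torusSupNorm (Mk (⟨d + 1, L, m, K, hd, hL⟩ : Params) j) (rep (Mk (⟨d + 1, L, m, K, hd, hL⟩ : Params) j) t - rep (Mk (⟨d + 1, L, m, K, hd, hL⟩ : Params) j) t')) := torusDist_isPseudoDist (Mk (⟨d + 1, L, m, K, hd, hL⟩ : Params) j)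
  have hK : SumBound (fun t t' : Site (⟨d + 1, L, m, K, hd, hL⟩ : Params) j => torusSupNorm (Mk (⟨d + 1, L, m, K, hd, hL⟩ : Params) j) (rep (Mk (⟨d + 1, L, m, K, hd, hL⟩ : Params) j) t - rep (Mk (⟨d + 1, L, m, K, hd, hL⟩ : Params) j) t')) (fun a => latticeConst (d + 1) a) := torusDist_sumBound (Mk (⟨d + 1, L, m, K, hd, hL⟩ : Params) j)
  have ht0 : 0 ≤ (((supDist b₁.src b₂.src : ℕ) : ℝ) / (L : ℝ) ^ j) := div_nonneg (Nat.cast_nonneg _) hLj.le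
  have ht1 : (((supDist b₁.src b₂.src : ℕ) : ℝ) / (L : ℝ) ^ j) ≤ 1 := by
    rw [div_le_one hLj]
    exact_mod_cast hle
  have htα : (((supDist b₁.src b₂.src : ℕ) : ℝ) / (L : ℝ) ^ j) ≤ (((supDist b₁.src b₂.src : ℕ) : ℝ) / (L : ℝ) ^ j) ^ α := self_le_rpow_of_le_one' ht0 ht1 hα1.le
  have htα0 : 0 ≤ (((supDist b₁.src b₂.src : ℕ) : ℝ) / (L : ℝ) ^ j) ^ α := Real.rpow_nonneg ht0 _
  -- (a) the ingredients: pair bounds (first factors; Lipschitz ones via `t ≤ t^α`) and block bounds (tails) at the rate `δ₀` (`K₁∇*` at `δ₀/4`)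
  have pK1D := holderBound_mono hρ _ (fun b₀ : PBond (⟨d + 1, L, m, K, hd, hL⟩ : Params) 0 => iterBlockOf j b₀.src) b₁ b₂ (iterBlockOf j b₁.src)
    (C := C₁ * (((supDist b₁.src b₂.src : ℕ) : ℝ) / (L : ℝ) ^ j)) (C' := C₁ * (((supDist b₁.src b₂.src : ℕ) : ℝ) / (L : ℝ) ^ j) ^ α) (mul_nonneg hC₁ htα0) (mul_le_mul_of_nonneg_left htα hC₁) (hq.trans h01)
    (hK1D m K j hc hj Λ' w hw lam b₁ b₂ hdir hle)
  have bK2D := blockBound_mono hρ _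
    (fun b₀ : PBond (⟨d + 1, L, m, K, hd, hL⟩ : Params) 0 => iterBlockOf j b₀.src) (fun b₀ : PBond (⟨d + 1, L, m, K, hd, hL⟩ : Params) 0 => iterBlockOf j b₀.src) hC₂ le_rfl h02 (hK2D m K j hc hj Λ' w hw lam)
  have pK2a := holderBound_mono hρ _ (fun b₀ : PBond (⟨d + 1, L, m, K, hd, hL⟩ : Params) 0 => iterBlockOf j b₀.src) b₁ b₂ (iterBlockOf j b₁.src)
    (C := C₃ * (((supDist b₁.src b₂.src : ℕ) : ℝ) / (L : ℝ) ^ j)) (C' := C₃ * (((supDist b₁.src b₂.src : ℕ) : ℝ) / (L : ℝ) ^ j) ^ α) (mul_nonneg hC₃ htα0) (mul_le_mul_of_nonneg_left htα hC₃) h03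
    (hK2a m K j hc hj Λ' w hw b₁ b₂ hdir hle)
  have bHCH := blockBound_mono hρ _
    (fun b₀ : PBond (⟨d + 1, L, m, K, hd, hL⟩ : Params) 0 => iterBlockOf j b₀.src) (fun b₀ : PBond (⟨d + 1, L, m, K, hd, hL⟩ : Params) 0 => iterBlockOf j b₀.src) hC₄ le_rfl h04 (hHCH m K j hc hj Λ' w hw0 hw1)
  have bGt := blockBound_mono hρ _
    (fun b₀ : PBond (⟨d + 1, L, m, K, hd, hL⟩ : Params) 0 => iterBlockOf j b₀.src) (fun b₀ : PBond (⟨d + 1, L, m, K, hd, hL⟩ : Params) 0 => iterBlockOf j b₀.src) hC₅ le_rfl h05 (hGt m K j hc hj Λ' w hw)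
  have bHCHD := blockBound_mono hρ _
    (fun b₀ : PBond (⟨d + 1, L, m, K, hd, hL⟩ : Params) 0 => iterBlockOf j b₀.src) (fun b₀ : PBond (⟨d + 1, L, m, K, hd, hL⟩ : Params) 0 => iterBlockOf j b₀.src) hC₆ le_rfl h06
    (hHCHD m K j hc hj Λ' w hw0 hw1 lam)
  have bGtD := blockBound_mono hρ _
    (fun b₀ : PBond (⟨d + 1, L, m, K, hd, hL⟩ : Params) 0 => iterBlockOf j b₀.src) (fun b₀ : PBond (⟨d + 1, L, m, K, hd, hL⟩ : Params) 0 => iterBlockOf j b₀.src) hC₇ le_rfl h07 (hGtD m K j hc hj Λ' w hw lam)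
  have pHCH := holderBound_mono hρ _
    (fun b₀ : PBond (⟨d + 1, L, m, K, hd, hL⟩ : Params) 0 => iterBlockOf j b₀.src) b₁ b₂ (iterBlockOf j b₁.src)
    (C := C₈ * (((supDist b₁.src b₂.src : ℕ) : ℝ) / (L : ℝ) ^ j)) (C' := C₈ * (((supDist b₁.src b₂.src : ℕ) : ℝ) / (L : ℝ) ^ j) ^ α) (mul_nonneg hC₈ htα0) (mul_le_mul_of_nonneg_left htα hC₈) h08
    (hpHCH m K j hc hj Λ' w hw0 hw1 b₁ b₂ hdir hle)
  have pGt := holderBound_mono hρ _ (fun b₀ : PBond (⟨d + 1, L, m, K, hd, hL⟩ : Params) 0 => iterBlockOf j b₀.src) b₁ b₂ (iterBlockOf j b₁.src)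
    (C := C₉ * (((supDist b₁.src b₂.src : ℕ) : ℝ) / (L : ℝ) ^ j)) (C' := C₉ * (((supDist b₁.src b₂.src : ℕ) : ℝ) / (L : ℝ) ^ j) ^ α) (mul_nonneg hC₉ htα0) (mul_le_mul_of_nonneg_left htα hC₉) h09
    (hpGt m K j hc hj Λ' w hw b₁ b₂ hdir hle)
  have pHCHD := holderBound_mono hρ _
    (fun b₀ : PBond (⟨d + 1, L, m, K, hd, hL⟩ : Params) 0 => iterBlockOf j b₀.src) b₁ b₂ (iterBlockOf j b₁.src)
    (C := C₁₀ * (((supDist b₁.src b₂.src : ℕ) : ℝ) / (L : ℝ) ^ j)) (C' := C₁₀ * (((supDist b₁.src b₂.src : ℕ) : ℝ) / (L : ℝ) ^ j) ^ α) (mul_nonneg hC₁₀ htα0) (mul_le_mul_of_nonneg_left htα hC₁₀) h010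
    (hpHCHD m K j hc hj Λ' w hw0 hw1 lam b₁ b₂ hdir hle)
  have pGtD := holderBound_mono hρ _ (fun b₀ : PBond (⟨d + 1, L, m, K, hd, hL⟩ : Params) 0 => iterBlockOf j b₀.src) b₁ b₂ (iterBlockOf j b₁.src)
    (C' := C₁₁ * (((supDist b₁.src b₂.src : ℕ) : ℝ) / (L : ℝ) ^ j) ^ α) (mul_nonneg hC₁₁ htα0) le_rfl h011 (hpGtD m K j hc hj Λ' w hw lam b₁ b₂ hdir hle)
  -- (b) `M = G̃_j + H_jC̃H_j*`, `M∇* = G̃_j∇* + H_jC̃H_j*∇*`, `M(K₂∇*)`, `Y = M∇* − M(K₂∇*)` — block and pair bounds at the rate `δ₀/2`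
  have bM := blockBound_add (ρ := (fun t t' : Site (⟨d + 1, L, m, K, hd, hL⟩ : Params) j => torusSupNorm (Mk (⟨d + 1, L, m, K, hd, hL⟩ : Params) j) (rep (Mk (⟨d + 1, L, m, K, hd, hL⟩ : Params) j) t - rep (Mk (⟨d + 1, L, m, K, hd, hL⟩ : Params) j) t'))) _ _
    (fun b₀ : PBond (⟨d + 1, L, m, K, hd, hL⟩ : Params) 0 => iterBlockOf j b₀.src) (fun b₀ : PBond (⟨d + 1, L, m, K, hd, hL⟩ : Params) 0 => iterBlockOf j b₀.src) bGt bHCH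
  have pM := holderBound_add (ρ := (fun t t' : Site (⟨d + 1, L, m, K, hd, hL⟩ : Params) j => torusSupNorm (Mk (⟨d + 1, L, m, K, hd, hL⟩ : Params) j) (rep (Mk (⟨d + 1, L, m, K, hd, hL⟩ : Params) j) t - rep (Mk (⟨d + 1, L, m, K, hd, hL⟩ : Params) j) t'))) _ _
    (fun b₀ : PBond (⟨d + 1, L, m, K, hd, hL⟩ : Params) 0 => iterBlockOf j b₀.src) b₁ b₂ (iterBlockOf j b₁.src) pGt pHCH
  have bMD := blockBound_add (ρ := (fun t t' : Site (⟨d + 1, L, m, K, hd, hL⟩ : Params) j => torusSupNorm (Mk (⟨d + 1, L, m, K, hd, hL⟩ : Params) j) (rep (Mk (⟨d + 1, L, m, K, hd, hL⟩ : Params) j) t - rep (Mk (⟨d + 1, L, m, K, hd, hL⟩ : Params) j) t'))) _ _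
    (fun b₀ : PBond (⟨d + 1, L, m, K, hd, hL⟩ : Params) 0 => iterBlockOf j b₀.src) (fun b₀ : PBond (⟨d + 1, L, m, K, hd, hL⟩ : Params) 0 => iterBlockOf j b₀.src) bGtD bHCHD
  have pMD := holderBound_add (ρ := (fun t t' : Site (⟨d + 1, L, m, K, hd, hL⟩ : Params) j => torusSupNorm (Mk (⟨d + 1, L, m, K, hd, hL⟩ : Params) j) (rep (Mk (⟨d + 1, L, m, K, hd, hL⟩ : Params) j) t - rep (Mk (⟨d + 1, L, m, K, hd, hL⟩ : Params) j) t'))) _ _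
    (fun b₀ : PBond (⟨d + 1, L, m, K, hd, hL⟩ : Params) 0 => iterBlockOf j b₀.src) b₁ b₂ (iterBlockOf j b₁.src) pGtD pHCHD
  have bMK2D := blockBound_comp hρ hK _ _
    (fun b₀ : PBond (⟨d + 1, L, m, K, hd, hL⟩ : Params) 0 => iterBlockOf j b₀.src) (fun b₀ : PBond (⟨d + 1, L, m, K, hd, hL⟩ : Params) 0 => iterBlockOf j b₀.src) (fun b₀ : PBond (⟨d + 1, L, m, K, hd, hL⟩ : Params) 0 => iterBlockOf j b₀.src)
    (Cf := C₅ + C₄) (Cg := C₂) (add_nonneg hC₅ hC₄) hC₂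
    hh0 hh hh2 bM bK2D
  have pMK2D := holderBound_comp hρ hK _ _
    (fun b₀ : PBond (⟨d + 1, L, m, K, hd, hL⟩ : Params) 0 => iterBlockOf j b₀.src) (fun b₀ : PBond (⟨d + 1, L, m, K, hd, hL⟩ : Params) 0 => iterBlockOf j b₀.src) b₁ b₂ (iterBlockOf j b₁.src)
    (Cf := C₉ * (((supDist b₁.src b₂.src : ℕ) : ℝ) / (L : ℝ) ^ j) ^ α + C₈ * (((supDist b₁.src b₂.src : ℕ) : ℝ) / (L : ℝ) ^ j) ^ α) (Cg := C₂) (add_nonneg (mul_nonneg hC₉ htα0) (mul_nonneg hC₈ htα0)) hC₂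
    hh0 hh hh2 pM bK2D
  have bMD' := blockBound_mono hρ _
    (fun b₀ : PBond (⟨d + 1, L, m, K, hd, hL⟩ : Params) 0 => iterBlockOf j b₀.src) (fun b₀ : PBond (⟨d + 1, L, m, K, hd, hL⟩ : Params) 0 => iterBlockOf j b₀.src)
    (add_nonneg hC₇ hC₆) le_rfl hh bMD
  have pMD' := holderBound_mono hρ _
    (fun b₀ : PBond (⟨d + 1, L, m, K, hd, hL⟩ : Params) 0 => iterBlockOf j b₀.src) b₁ b₂ (iterBlockOf j b₁.src)
    (C' := C₁₁ * (((supDist b₁.src b₂.src : ℕ) : ℝ) / (L : ℝ) ^ j) ^ α + C₁₀ * (((supDist b₁.src b₂.src : ℕ) : ℝ) / (L : ℝ) ^ j) ^ α) (add_nonneg (mul_nonneg hC₁₁ htα0) (mul_nonneg hC₁₀ htα0)) le_rfl hh pMD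
  have bMK2D' := blockBound_mono hρ _
    (fun b₀ : PBond (⟨d + 1, L, m, K, hd, hL⟩ : Params) 0 => iterBlockOf j b₀.src) (fun b₀ : PBond (⟨d + 1, L, m, K, hd, hL⟩ : Params) 0 => iterBlockOf j b₀.src)
    (C' := (C₅ + C₄) * C₂ * Ka) (mul_nonneg (mul_nonneg (add_nonneg hC₅ hC₄) hC₂) hKa0) (le_of_eq (by rw [hKa])) le_rfl bMK2D
  have pMK2D' := holderBound_mono hρ _
    (fun b₀ : PBond (⟨d + 1, L, m, K, hd, hL⟩ : Params) 0 => iterBlockOf j b₀.src) b₁ b₂ (iterBlockOf j b₁.src)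
    (C' := (C₉ * (((supDist b₁.src b₂.src : ℕ) : ℝ) / (L : ℝ) ^ j) ^ α + C₈ * (((supDist b₁.src b₂.src : ℕ) : ℝ) / (L : ℝ) ^ j) ^ α) * C₂ * Ka)
    (mul_nonneg (mul_nonneg (add_nonneg (mul_nonneg hC₉ htα0) (mul_nonneg hC₈ htα0)) hC₂) hKa0) (le_of_eq (by rw [hKa])) le_rfl pMK2D
  have bY := blockBound_sub (ρ := (fun t t' : Site (⟨d + 1, L, m, K, hd, hL⟩ : Params) j => torusSupNorm (Mk (⟨d + 1, L, m, K, hd, hL⟩ : Params) j) (rep (Mk (⟨d + 1, L, m, K, hd, hL⟩ : Params) j) t - rep (Mk (⟨d + 1, L, m, K, hd, hL⟩ : Params) j) t'))) _ _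
    (fun b₀ : PBond (⟨d + 1, L, m, K, hd, hL⟩ : Params) 0 => iterBlockOf j b₀.src) (fun b₀ : PBond (⟨d + 1, L, m, K, hd, hL⟩ : Params) 0 => iterBlockOf j b₀.src) bMD' bMK2D'
  have pY := holderBound_sub (ρ := (fun t t' : Site (⟨d + 1, L, m, K, hd, hL⟩ : Params) j => torusSupNorm (Mk (⟨d + 1, L, m, K, hd, hL⟩ : Params) j) (rep (Mk (⟨d + 1, L, m, K, hd, hL⟩ : Params) j) t - rep (Mk (⟨d + 1, L, m, K, hd, hL⟩ : Params) j) t'))) _ _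
    (fun b₀ : PBond (⟨d + 1, L, m, K, hd, hL⟩ : Params) 0 => iterBlockOf j b₀.src) b₁ b₂ (iterBlockOf j b₁.src) pMD' pMK2D'
  -- (c) `K₂*Y` at the rate `δ₀/4`; `Y − K₂*Y`; the sum with `K₁∇*`
  have pK2aY := holderBound_comp hρ hK _ _
    (fun b₀ : PBond (⟨d + 1, L, m, K, hd, hL⟩ : Params) 0 => iterBlockOf j b₀.src) (fun b₀ : PBond (⟨d + 1, L, m, K, hd, hL⟩ : Params) 0 => iterBlockOf j b₀.src) b₁ b₂ (iterBlockOf j b₁.src)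
    (Cf := C₃ * (((supDist b₁.src b₂.src : ℕ) : ℝ) / (L : ℝ) ^ j) ^ α) (Cg := CY) (mul_nonneg hC₃ htα0) hCY0
    h40 h42 h4lt pK2a
    (fun i y => (bY i y).trans (le_of_eq (by rw [hCY])))
  have pK2aY' := holderBound_mono hρ _
    (fun b₀ : PBond (⟨d + 1, L, m, K, hd, hL⟩ : Params) 0 => iterBlockOf j b₀.src) b₁ b₂ (iterBlockOf j b₁.src)
    (C' := C₃ * (((supDist b₁.src b₂.src : ℕ) : ℝ) / (L : ℝ) ^ j) ^ α * CY * Kb) (mul_nonneg (mul_nonneg (mul_nonneg hC₃ htα0) hCY0) hKb0) (le_of_eq (by rw [hKb])) le_rfl pK2aY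
  have pY' := holderBound_mono hρ _
    (fun b₀ : PBond (⟨d + 1, L, m, K, hd, hL⟩ : Params) 0 => iterBlockOf j b₀.src) b₁ b₂ (iterBlockOf j b₁.src)
    (C' := (C₁₁ * (((supDist b₁.src b₂.src : ℕ) : ℝ) / (L : ℝ) ^ j) ^ α + C₁₀ * (((supDist b₁.src b₂.src : ℕ) : ℝ) / (L : ℝ) ^ j) ^ α) + (C₉ * (((supDist b₁.src b₂.src : ℕ) : ℝ) / (L : ℝ) ^ j) ^ α + C₈ * (((supDist b₁.src b₂.src : ℕ) : ℝ) / (L : ℝ) ^ j) ^ α) * C₂ * Ka)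
    (add_nonneg (add_nonneg (mul_nonneg hC₁₁ htα0) (mul_nonneg hC₁₀ htα0))
      (mul_nonneg (mul_nonneg (add_nonneg (mul_nonneg hC₉ htα0) (mul_nonneg hC₈ htα0)) hC₂) hKa0))
    le_rfl h42 pY
  have pZ := holderBound_sub (ρ := (fun t t' : Site (⟨d + 1, L, m, K, hd, hL⟩ : Params) j => torusSupNorm (Mk (⟨d + 1, L, m, K, hd, hL⟩ : Params) j) (rep (Mk (⟨d + 1, L, m, K, hd, hL⟩ : Params) j) t - rep (Mk (⟨d + 1, L, m, K, hd, hL⟩ : Params) j) t'))) _ _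
    (fun b₀ : PBond (⟨d + 1, L, m, K, hd, hL⟩ : Params) 0 => iterBlockOf j b₀.src) b₁ b₂ (iterBlockOf j b₁.src) pY' pK2aY'
  have ptot := holderBound_add (ρ := (fun t t' : Site (⟨d + 1, L, m, K, hd, hL⟩ : Params) j => torusSupNorm (Mk (⟨d + 1, L, m, K, hd, hL⟩ : Params) j) (rep (Mk (⟨d + 1, L, m, K, hd, hL⟩ : Params) j) t - rep (Mk (⟨d + 1, L, m, K, hd, hL⟩ : Params) j) t'))) _ _
    (fun b₀ : PBond (⟨d + 1, L, m, K, hd, hL⟩ : Params) 0 => iterBlockOf j b₀.src) b₁ b₂ (iterBlockOf j b₁.src) pK1D pZ y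
  -- (d) the algebra: `G∇* = K₁∇* + (Y − K₂*Y)` (p22 file 14's identity `G_eq_op_V1` through the generic `comp_eq_of_G_eq`)
  rw [comp_eq_of_G_eq (G_eq_op_V1 hc hj Λ' hw)]
  refine ptot.trans (le_of_eq ?_)
  rw [hC]
  ring

/-! ## §2  The printed shape: `‖ζG∇*J‖_α ≤ O(1)e^{−δ₂|y − y′|}(‖ζ‖_α + |ζ|)|J|` -/

open Classical in
/-- **PROPOSITION 2.5, THE MEMBER `‖ζG∇*J‖_α` OF (1.111) IN THE PRINTED SHAPE** for the genuine two-scale `G` of (2.90), `Λ′` arbitrary (at `c = L^j`,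
weights `a₀n^{d+1} ≤ w ≤ a₁n^{d+1}`), one component `λ` of the divergence: there is `δ₂ > 0` depending on `d, L, a₀, a₁` only and for every
`0 ≤ α < 1` a `C_α ≥ 0` such that for every volume, `j + 1 ≤ m + K`, `Λ′`, weights in the window, direction `λ`, radius `r ≥ 0`, every fine bond
field `J` supported on the fine bonds over the unit sites within `r` of `y′` with `|J| ≤ X`, every cut-off `ζ` on the fine sites supported over
the unit sites within `r` of `y` with `|ζ| ≤ Z₀`, and every pair of fine bonds `b₁ = ⟨x, ν⟩`, `b₂ = ⟨x′, ν⟩` with `|x − x′|_∞ ≤ n`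
(`t = |x − x′|_∞/n`) and `|ζ(x) − ζ(x′)| ≤ Z_h·t^α`:
`|ζ(x)(G∇_λ*J)_ν(x) − ζ(x′)(G∇_λ*J)_ν(x′)| ≤ C_α·e^{(1+2δ₂)(r+1)}·e^{−δ₂|y − y′|_T}·(Z_h + Z₀)·X·t^α`, `(∇_λ*J)(b) = n(J(b − e_λ) − J(b))`.
[cite: Balaban1984PropagatorsII, Prop. 2.5 p.246; Balaban1984PropagatorsI, (1.109), (1.111) p.35] -/
theorem prop25_ineq111_div (d L : ℕ) (hd : 1 ≤ d + 1) (hL : Odd L ∧ 1 < L) {a₀ a₁ : ℝ} (ha₀ : 0 < a₀) (ha₁ : a₀ ≤ a₁) :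
    ∃ δ : ℝ, 0 < δ ∧ ∀ α : ℝ, 0 ≤ α → α < 1 → ∃ C : ℝ, 0 ≤ C ∧ ∀ (m K : ℕ) (j : ℕ) (hc : ((L : ℝ) ^ j) ≠ 0)
      (_hj : j + 1 ≤ (⟨d + 1, L, m, K, hd, hL⟩ : Params).m + (⟨d + 1, L, m, K, hd, hL⟩ : Params).K)
      (Λ' : Finset (Site (⟨d + 1, L, m, K, hd, hL⟩ : Params) (j + 1))) (w : CIdx j Λ' → ℝ)
      (_hw0 : ∀ i, a₀ * ((L : ℝ) ^ j) ^ (d + 1) ≤ w i) (_hw1 : ∀ i, w i ≤ a₁ * ((L : ℝ) ^ j) ^ (d + 1)) (lam : Fin (d + 1))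
      (r : ℝ) (_hr : 0 ≤ r) (J : BondSpace (⟨d + 1, L, m, K, hd, hL⟩ : Params)) (X : ℝ) (_hX : 0 ≤ X) (y y' : Site (⟨d + 1, L, m, K, hd, hL⟩ : Params) j)
      (_hsupp : ∀ b : PBond (⟨d + 1, L, m, K, hd, hL⟩ : Params) 0, J b ≠ 0 →
        torusSupNorm (Mk (⟨d + 1, L, m, K, hd, hL⟩ : Params) j) (rep (Mk (⟨d + 1, L, m, K, hd, hL⟩ : Params) j) (iterBlockOf j b.src) - rep (Mk (⟨d + 1, L, m, K, hd, hL⟩ : Params) j) y') ≤ r)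
      (_hJ : ∀ b : PBond (⟨d + 1, L, m, K, hd, hL⟩ : Params) 0, |J b| ≤ X)
      (ζ : Site (⟨d + 1, L, m, K, hd, hL⟩ : Params) 0 → ℝ) (Zh Z0 : ℝ) (_hZh : 0 ≤ Zh) (_hZ0 : 0 ≤ Z0)
      (_hζs : ∀ x : Site (⟨d + 1, L, m, K, hd, hL⟩ : Params) 0, ζ x ≠ 0 →
        torusSupNorm (Mk (⟨d + 1, L, m, K, hd, hL⟩ : Params) j) (rep (Mk (⟨d + 1, L, m, K, hd, hL⟩ : Params) j) (iterBlockOf j x) - rep (Mk (⟨d + 1, L, m, K, hd, hL⟩ : Params) j) y) ≤ r)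
      (_hζ0 : ∀ x : Site (⟨d + 1, L, m, K, hd, hL⟩ : Params) 0, |ζ x| ≤ Z0)
      (b₁ b₂ : PBond (⟨d + 1, L, m, K, hd, hL⟩ : Params) 0) (_hdir : b₁.dir = b₂.dir) (_hle : supDist b₁.src b₂.src ≤ L ^ j)
      (_hζh : |ζ b₁.src - ζ b₂.src| ≤ Zh * (((supDist b₁.src b₂.src : ℕ) : ℝ) / (L : ℝ) ^ j) ^ α),
      |ζ b₁.src * (tsV1 hc Λ' w).G (((((L : ℝ) ^ j) • (onE (LinearMap.funLeft ℝ ℝ (fun b : PBond (⟨d + 1, L, m, K, hd, hL⟩ : Params) 0 => (⟨b.src.unshift lam, b.dir⟩ : PBond (⟨d + 1, L, m, K, hd, hL⟩ : Params) 0))) - LinearMap.id) : BondSpace (⟨d + 1, L, m, K, hd, hL⟩ : Params) →ₗ[ℝ] BondSpace (⟨d + 1, L, m, K, hd, hL⟩ : Params))) J) b₁ - ζ b₂.src * (tsV1 hc Λ' w).G (((((L : ℝ) ^ j) • (onE (LinearMap.funLeft ℝ ℝ (fun b : PBond (⟨d + 1, L, m, K, hd, hL⟩ : Params) 0 => (⟨b.src.unshift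 lam, b.dir⟩ : PBond (⟨d + 1, L, m, K, hd, hL⟩ : Params) 0))) - LinearMap.id) : BondSpace (⟨d + 1, L, m, K, hd, hL⟩ : Params) →ₗ[ℝ] BondSpace (⟨d + 1, L, m, K, hd, hL⟩ : Params))) J) b₂| ≤
        C * Real.exp ((1 + 2 * δ) * (r + 1)) *
          Real.exp (-(δ * torusSupNorm (Mk (⟨d + 1, L, m, K, hd, hL⟩ : Params) j) (rep (Mk (⟨d + 1, L, m, K, hd, hL⟩ : Params) j) y - rep (Mk (⟨d + 1, L, m, K, hd, hL⟩ : Params) j) y'))) * (Zh + Z0) * X * (((supDist b₁.src b₂.src : ℕ) : ℝ) / (L : ℝ) ^ j) ^ α := by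
  obtain ⟨δS, hδS, CS, hCS, hS⟩ := blockBound_GDadj_scaling d L hd hL ha₀ ha₁
  obtain ⟨δH, hδH, HH⟩ := holderBound_GDadj_scaling d L hd hL ha₀ ha₁
  refine ⟨min δS δH, lt_min hδS hδH, fun α hα0 hα1 => ?_⟩
  obtain ⟨CH, hCH, hH⟩ := HH α hα0 hα1
  have hK10 : 0 ≤ latticeConst (d + 1) 1 := latticeConst_nonneg _ zero_le_one
  refine ⟨(CS + CH) * latticeConst (d + 1) 1, by positivity, ?_⟩
  intro m K j hc hj Λ' w hw0 hw1 lam r hr J X hX y y' hsupp hJ ζ Zh Z0 hZh hZ0 hζs hζ0 b₁ b₂ hdir hle hζh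
  have hj' : j ≤ m + K := Nat.le_of_succ_le hj
  have hL0 : 0 < L := by have := hL.2; omega
  have hLp : (0 : ℝ) < L := by exact_mod_cast hL0
  have hLj : (0 : ℝ) < (L : ℝ) ^ j := by positivity
  set δ' : ℝ := min δS δH with hδ'
  have hδ'0 : 0 ≤ δ' := le_min hδS.le hδH.le
  have hδ'S : δ' ≤ δS := min_le_left _ _
  have hδ'H : δ' ≤ δH := min_le_right _ _
  have ht0 : 0 ≤ (((supDist b₁.src b₂.src : ℕ) : ℝ) / (L : ℝ) ^ j) := by positivity
  have htα0 : 0 ≤ (((supDist b₁.src b₂.src : ℕ) : ℝ) / (L : ℝ) ^ j) ^ α := Real.rpow_nonneg ht0 _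
  have hρ : IsPseudoDist (fun t t' : Site (⟨d + 1, L, m, K, hd, hL⟩ : Params) j => torusSupNorm (Mk (⟨d + 1, L, m, K, hd, hL⟩ : Params) j) (rep (Mk (⟨d + 1, L, m, K, hd, hL⟩ : Params) j) t - rep (Mk (⟨d + 1, L, m, K, hd, hL⟩ : Params) j) t')) := torusDist_isPseudoDist (Mk (⟨d + 1, L, m, K, hd, hL⟩ : Params) j)
  have hK : SumBound (fun t t' : Site (⟨d + 1, L, m, K, hd, hL⟩ : Params) j => torusSupNorm (Mk (⟨d + 1, L, m, K, hd, hL⟩ : Params) j) (rep (Mk (⟨d + 1, L, m, K, hd, hL⟩ : Params) j) t - rep (Mk (⟨d + 1, L, m, K, hd, hL⟩ : Params) j) t')) (fun a => latticeConst (d + 1) a) := torusDist_sumBound (Mk (⟨d + 1, L, m, K, hd, hL⟩ : Params) j)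
  -- the trivial case: both values of the cut-off vanish
  by_cases hz : ζ b₁.src = 0 ∧ ζ b₂.src = 0
  · rw [hz.1, hz.2, zero_mul, zero_mul, sub_zero, abs_zero]
    positivity
  -- otherwise the anchor `y(x)` is within `r + 1` of `y` (`|y(x) − y(x′)|_T ≤ 1`)
  have hz1 : torusSupNorm (Mk (⟨d + 1, L, m, K, hd, hL⟩ : Params) j) (rep (Mk (⟨d + 1, L, m, K, hd, hL⟩ : Params) j) (iterBlockOf j b₁.src) - rep (Mk (⟨d + 1, L, m, K, hd, hL⟩ : Params) j) y) ≤ r + 1 := by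
    rw [not_and_or] at hz
    rcases hz with h1 | h2
    · exact (hζs _ h1).trans (by linarith)
    · have h12 : torusSupNorm (Mk (⟨d + 1, L, m, K, hd, hL⟩ : Params) j) (rep (Mk (⟨d + 1, L, m, K, hd, hL⟩ : Params) j) (iterBlockOf j b₁.src) - rep (Mk (⟨d + 1, L, m, K, hd, hL⟩ : Params) j) (iterBlockOf j b₂.src)) ≤ 1 := by
        rw [← supDist_cast_eq_torusSupNorm]
        exact_mod_cast supDist_blk_le_one hj' b₁.src b₂.src hle
      calc torusSupNorm (Mk (⟨d + 1, L, m, K, hd, hL⟩ : Params) j) (rep (Mk (⟨d + 1, L, m, K, hd, hL⟩ : Params) j) (iterBlockOf j b₁.src) - rep (Mk (⟨d + 1, L, m, K, hd, hL⟩ : Params) j) y)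
          ≤ torusSupNorm (Mk (⟨d + 1, L, m, K, hd, hL⟩ : Params) j) (rep (Mk (⟨d + 1, L, m, K, hd, hL⟩ : Params) j) (iterBlockOf j b₁.src) - rep (Mk (⟨d + 1, L, m, K, hd, hL⟩ : Params) j) (iterBlockOf j b₂.src)) +
            torusSupNorm (Mk (⟨d + 1, L, m, K, hd, hL⟩ : Params) j) (rep (Mk (⟨d + 1, L, m, K, hd, hL⟩ : Params) j) (iterBlockOf j b₂.src) - rep (Mk (⟨d + 1, L, m, K, hd, hL⟩ : Params) j) y) := hρ.triangle _ _ _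
        _ ≤ 1 + r := add_le_add h12 (hζs _ h2)
        _ = r + 1 := add_comm _ _
  -- the sup part `|(G∇_λ*J)_ν(x)|` at the rate `δ'` (p22 file 14)
  have bS := blockBound_mono hρ ((tsV1 hc Λ' w).G ∘ₗ ((((L : ℝ) ^ j) • (onE (LinearMap.funLeft ℝ ℝ (fun b : PBond (⟨d + 1, L, m, K, hd, hL⟩ : Params) 0 => (⟨b.src.unshift lam, b.dir⟩ : PBond (⟨d + 1, L, m, K, hd, hL⟩ : Params) 0))) - LinearMap.id) : BondSpace (⟨d + 1, L, m, K, hd, hL⟩ : Params) →ₗ[ℝ] BondSpace (⟨d + 1, L, m, K, hd, hL⟩ : Params))))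
    (fun b₀ : PBond (⟨d + 1, L, m, K, hd, hL⟩ : Params) 0 => iterBlockOf j b₀.src) (fun b₀ : PBond (⟨d + 1, L, m, K, hd, hL⟩ : Params) 0 => iterBlockOf j b₀.src) hCS le_rfl hδ'S (hS m K j hc hj Λ' w hw0 hw1 lam)
  have hSx := abs_apply_le_of_support hρ hK ((tsV1 hc Λ' w).G ∘ₗ ((((L : ℝ) ^ j) • (onE (LinearMap.funLeft ℝ ℝ (fun b : PBond (⟨d + 1, L, m, K, hd, hL⟩ : Params) 0 => (⟨b.src.unshift lam, b.dir⟩ : PBond (⟨d + 1, L, m, K, hd, hL⟩ : Params) 0))) - LinearMap.id) : BondSpace (⟨d + 1, L, m, K, hd, hL⟩ : Params) →ₗ[ℝ] BondSpace (⟨d + 1, L, m, K, hd, hL⟩ : Params))))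
    (fun b₀ : PBond (⟨d + 1, L, m, K, hd, hL⟩ : Params) 0 => iterBlockOf j b₀.src) (fun b₀ : PBond (⟨d + 1, L, m, K, hd, hL⟩ : Params) 0 => iterBlockOf j b₀.src) hCS hδ'0 hX bS J y y'
    (fun k hk => (hsupp k hk).trans (by linarith)) hJ b₁ hz1
  rw [LinearMap.comp_apply] at hSx
  -- the pair part at the rate `δ'` (§1)
  have pH := holderBound_mono hρ ((tsV1 hc Λ' w).G ∘ₗ ((((L : ℝ) ^ j) • (onE (LinearMap.funLeft ℝ ℝ (fun b : PBond (⟨d + 1, L, m, K, hd, hL⟩ : Params) 0 => (⟨b.src.unshift lam, b.dir⟩ : PBond (⟨d + 1, L, m, K, hd, hL⟩ : Params) 0))) - LinearMap.id) : BondSpace (⟨d + 1, L, m, K, hd, hL⟩ : Params) →ₗ[ℝ] BondSpace (⟨d + 1, L, m, K, hd, hL⟩ : Params)))) (fun b₀ : PBond (⟨d + 1, L, m, K, hd, hL⟩ : Params) 0 => iterBlockOf j b₀.src) b₁ b₂ (iterBlockOf j b₁.src)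
    (C' := CH * (((supDist b₁.src b₂.src : ℕ) : ℝ) / (L : ℝ) ^ j) ^ α) (mul_nonneg hCH htα0) le_rfl hδ'H (hH m K j hc hj Λ' w hw0 hw1 lam b₁ b₂ hdir hle)
  have hHx := pairDiff_le_of_support hρ hK ((tsV1 hc Λ' w).G ∘ₗ ((((L : ℝ) ^ j) • (onE (LinearMap.funLeft ℝ ℝ (fun b : PBond (⟨d + 1, L, m, K, hd, hL⟩ : Params) 0 => (⟨b.src.unshift lam, b.dir⟩ : PBond (⟨d + 1, L, m, K, hd, hL⟩ : Params) 0))) - LinearMap.id) : BondSpace (⟨d + 1, L, m, K, hd, hL⟩ : Params) →ₗ[ℝ] BondSpace (⟨d + 1, L, m, K, hd, hL⟩ : Params)))) (fun b₀ : PBond (⟨d + 1, L, m, K, hd, hL⟩ : Params) 0 => iterBlockOf j b₀.src) b₁ b₂ (iterBlockOf j b₁.src)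
    (mul_nonneg hCH htα0) hδ'0 hX pH J y y' (fun k hk => (hsupp k hk).trans (by linarith)) hJ hz1
  rw [LinearMap.comp_apply] at hHx
  -- the cut-off product rule
  refine (abs_cutoff_pairDiff_le hSx hHx hζh (hζ0 b₂.src)).trans ?_
  have hE0 : 0 ≤ (((supDist b₁.src b₂.src : ℕ) : ℝ) / (L : ℝ) ^ j) ^ α * (latticeConst (d + 1) 1 * Real.exp ((1 + 2 * δ') * (r + 1)) *
      Real.exp (-(δ' * torusSupNorm (Mk (⟨d + 1, L, m, K, hd, hL⟩ : Params) j) (rep (Mk (⟨d + 1, L, m, K, hd, hL⟩ : Params) j) y - rep (Mk (⟨d + 1, L, m, K, hd, hL⟩ : Params) j) y')))) * X := by positivity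
  have hcoef : Zh * CS + Z0 * CH ≤ (CS + CH) * (Zh + Z0) := by nlinarith [mul_nonneg hCS hZ0, mul_nonneg hCH hZh]
  calc Zh * (((supDist b₁.src b₂.src : ℕ) : ℝ) / (L : ℝ) ^ j) ^ α * (CS * (latticeConst (d + 1) 1 * Real.exp ((1 + 2 * δ') * (r + 1))) *
          Real.exp (-(δ' * torusSupNorm (Mk (⟨d + 1, L, m, K, hd, hL⟩ : Params) j) (rep (Mk (⟨d + 1, L, m, K, hd, hL⟩ : Params) j) y - rep (Mk (⟨d + 1, L, m, K, hd, hL⟩ : Params) j) y'))) * X) +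
        Z0 * (CH * (((supDist b₁.src b₂.src : ℕ) : ℝ) / (L : ℝ) ^ j) ^ α * (latticeConst (d + 1) 1 * Real.exp ((1 + 2 * δ') * (r + 1))) *
          Real.exp (-(δ' * torusSupNorm (Mk (⟨d + 1, L, m, K, hd, hL⟩ : Params) j) (rep (Mk (⟨d + 1, L, m, K, hd, hL⟩ : Params) j) y - rep (Mk (⟨d + 1, L, m, K, hd, hL⟩ : Params) j) y'))) * X)
        = (Zh * CS + Z0 * CH) * ((((supDist b₁.src b₂.src : ℕ) : ℝ) / (L : ℝ) ^ j) ^ α * (latticeConst (d + 1) 1 * Real.exp ((1 + 2 * δ') * (r + 1)) *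
          Real.exp (-(δ' * torusSupNorm (Mk (⟨d + 1, L, m, K, hd, hL⟩ : Params) j) (rep (Mk (⟨d + 1, L, m, K, hd, hL⟩ : Params) j) y - rep (Mk (⟨d + 1, L, m, K, hd, hL⟩ : Params) j) y')))) * X) := by ring
    _ ≤ (CS + CH) * (Zh + Z0) * ((((supDist b₁.src b₂.src : ℕ) : ℝ) / (L : ℝ) ^ j) ^ α * (latticeConst (d + 1) 1 * Real.exp ((1 + 2 * δ') * (r + 1)) *
          Real.exp (-(δ' * torusSupNorm (Mk (⟨d + 1, L, m, K, hd, hL⟩ : Params) j) (rep (Mk (⟨d + 1, L, m, K, hd, hL⟩ : Params) j) y - rep (Mk (⟨d + 1, L, m, K, hd, hL⟩ : Params) j) y')))) * X) :=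
        mul_le_mul_of_nonneg_right hcoef hE0
    _ = _ := by rw [hδ']; ring

end Literature.MathematicalPhysics.QuantumFieldTheory.Balaban1983to89.B6Prop25HolderGDivTwoScaleV1

end
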